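import Mathlib
import Summits.NavierStokesRegularity.NavierStokesRegularity.Theorems.L3TimeExponentPincerScaledEnergyCausalCylinder
import Summits.NavierStokesRegularity.NavierStokesRegularity.Theorems.L3TimeExponentPincerPaceDichotomy
import HarnessLib.Audit
import HarnessLib

/-!
# On the Morrey-Type-I class every late TOP cylinder has Type-I-bounded dissipation and cubic
# functional up to the blow-up time (route `L3TimeExponentPincer`, child crux `EffSatBlowup`,
# stmt-NavierStokesRegularity-19139, line `pace`, stub 2's class `MorreyTypeINear`)

Support file for the child crux `EffSatBlowup` (cell ns-regularity-ideate, seat nsreg-p4 gen 6).  Line `pace`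
(nsreg-p2 ROUND-8) has the open stub `stub_morreyTypeI_slow : … → MorreyTypeINear u T → L3Slow u T`; its class
`MorreyTypeINear` (Barker–Prange 2020 (1.7): `∫_{B(x,r)} |u(t)|² ≤ M r` for `r < r₁` and `T - r² < t < T`) bounds
the scaled energy only on TOP windows, and the recorded obstruction (HANDOFF p4 g3/g4) is that no tree or print
estimate bounds `‖u(t)‖₃` from above on that class.  This file lands what the energy class DOES give there, by the
causal-cylinder bounds of `…Theorems.L3TimeExponentPincerScaledEnergyCausalCylinder` (Jia–Šverák 2014 Lemma 3.1
transported to the frame): the causal window of a top cylinder whose radius is a fixed multiple of the parabolic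
one REACHES THE BLOW-UP TIME, so

* `exists_topCylinder_bounds` — absolute `ε₁ > 0`, `K_E, K_C ≥ 0`: for every frame solution with the Morrey-Type-I
  bound (constants `M, r₁`), every `t ∈ (0,T)`, every radius `r < r₁` with `T - r² < t` and
  `T - t ≤ ε₁ r² min(ν⁻¹, ν³/M²)`, and every centre `x`:
  **`∫_t^T ∫_{B(x,r)} |∇u|² ≤ K_E M r/ν`** and **`∫_t^T ∫_{B(x,r)} |u|³ ≤ K_C M^{3/2} r²/ν`** —
  the scaled dissipation `E` and cubic functional `C` of the top cylinder `(t,T) × B(x,r)` are Type-I bounded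
  UP TO `T`;
* `exists_topCylinder_bounds_of_morreyTypeINear` — the same packaged on the predicate `MorreyTypeINear u T`:
  there are `c ≥ 2`, `K ≥ 0` (depending on `ν, M`) with the two bounds for all late top cylinders of radius
  `c √(T-t) ≤ r < r₁`; in particular (`cubic_parabolicTop_le_of_morreyTypeINear`) the TIME-AVERAGED local cubic
  pace on the parabolic top cylinder of radius `c√(T-t)` is Type I: `∫_t^T ∫_{B(x,c√(T-t))} |u|³ ≤ K c² (T-t)`
  at every centre — the local, time-averaged form of the `L³`-Type-I pace `L3Slow` that stub 2 asks for
  pointwise in time and globally in space.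

WHAT THIS IS NOT: not a claim about Navier–Stokes regularity or blow-up, and not stub 2 (the pointwise-in-time,
global-in-space pace remains open): an energy-class a priori bound on the stub's class, landed `--supports … --as
helper`; no item is closed.
-/

noncomputable section

namespace Summit.NavierStokesRegularity.NavierStokesRegularity.Theorems.L3TimeExponentPincerMorreyTypeITopCylinders

open MeasureTheory Set Function Filter Metric Topology TopologicalSpace
open scoped ENNReal NNReal
open Literature.Analysis.FluidPDE
open Summit.NavierStokesRegularity.NavierStokesRegularity.Theorems.L3TimeExponentPincerScaledEnergyCausalCylinder
  (exists_causalCylinder_bounds)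
open Summit.NavierStokesRegularity.NavierStokesRegularity.Theorems.L3TimeExponentPincerPaceDichotomy (MorreyTypeINear)

/-- **Top cylinders of the Morrey-Type-I class have Type-I-bounded `E` and `C` up to `T`.**  Absolute `ε₁ > 0`,
`K_E, K_C ≥ 0`: for a frame solution with `∫_{B(x,r)} |u(t')|² ≤ M r` for all `x`, all `r < r₁` and all
`t' ∈ (T - r², T)`, every `t ∈ (0,T)`, `r ∈ (0, r₁)` with `T - r² < t` and `T - t ≤ ε₁ r² min(ν⁻¹, ν³/M²)`,
and every centre `x`: `∫_t^T ∫_{B(x,r)} |∇u|²_F ≤ K_E M r/ν` and `∫_t^T ∫_{B(x,r)} |u|³ ≤ K_C M^{3/2} r²/ν`.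
[cite: JiaSverak2014, Lemma 3.1 (arXiv:1204.0529 p. 7)] [cite: BarkerPrange2020, (1.7)] -/
theorem exists_topCylinder_bounds :
    ∃ ε₁ : ℝ, 0 < ε₁ ∧ ∃ K_E : ℝ, 0 ≤ K_E ∧ ∃ K_C : ℝ, 0 ≤ K_C ∧
      ∀ (ν T : ℝ), 0 < ν → 0 < T →
      ∀ (u : ℝ → EuclideanSpace ℝ (Fin 3) → EuclideanSpace ℝ (Fin 3)) (p : ℝ → EuclideanSpace ℝ (Fin 3) → ℝ),
        IsClassicalNSSolutionOn (Ico 0 T) ν 0 u p → IsLerayHopfOn T ν 0 (u 0) u → HasRapidSpatialDecay (u 0) →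
        ∀ M r₁ : ℝ, 0 < M → 0 < r₁ →
          (∀ x : EuclideanSpace ℝ (Fin 3), ∀ r : ℝ, 0 < r → r < r₁ → ∀ t' : ℝ, T - r ^ 2 < t' → t' < T →
            ∫⁻ y in ball x r, ‖u t' y‖ₑ ^ 2 ≤ ENNReal.ofReal (M * r)) →
          ∀ t ∈ Ioo 0 T, ∀ r : ℝ, 0 < r → r < r₁ → T - r ^ 2 < t → T - t ≤ ε₁ * r ^ 2 * min ν⁻¹ (ν ^ 3 / M ^ 2) →
            ∀ x : EuclideanSpace ℝ (Fin 3),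
              (∫⁻ z in Ioo t T ×ˢ ball x r, ENNReal.ofReal (frobeniusNormSq (fderiv ℝ (u z.1) z.2))) ≤
                  ENNReal.ofReal (K_E * M * r / ν) ∧
              (∫⁻ z in Ioo t T ×ˢ ball x r, ‖u z.1 z.2‖ₑ ^ (3 : ℕ)) ≤
                  ENNReal.ofReal (K_C * M ^ (3 / 2 : ℝ) * r ^ 2 / ν) := by
  obtain ⟨ε₁, hε₁, K_E, hKE, K_C, hKC, h⟩ := exists_causalCylinder_bounds
  refine ⟨ε₁, hε₁, K_E, hKE, K_C, hKC, ?_⟩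
  intro ν T hν hT u p hcl hLH hdec M r₁ hM hr₁ hMTI t ht r hr hrr₁ htop hwin x
  have hdat : ∀ y : EuclideanSpace ℝ (Fin 3), ∫⁻ w in ball y r, ‖u t w‖ₑ ^ 2 ≤ ENNReal.ofReal (M * r) :=
    fun y => hMTI y r hr hrr₁ t htop ht.2
  have key := h ν T hν hT u p hcl hLH hdec t ht r hr M hM hdat x
  have hmin : min (ε₁ * r ^ 2 * min ν⁻¹ (ν ^ 3 / M ^ 2)) (T - t) = T - t := min_eq_right hwin
  rw [hmin, add_sub_cancel] at key
  exact key

/-- **Packaged on `MorreyTypeINear`.**  For a frame solution in the Morrey-Type-I class there are `c ≥ 2`, `r₁ > 0`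
and `K ≥ 0` such that every late top cylinder `(t,T) × B(x,r)` with `c √(T-t) ≤ r < r₁` has
`∫_t^T ∫_{B(x,r)} |∇u|²_F ≤ K r` and `∫_t^T ∫_{B(x,r)} |u|³ ≤ K r²`. -/
theorem exists_topCylinder_bounds_of_morreyTypeINear {ν T : ℝ} (hν : 0 < ν) (hT : 0 < T)
    {u : ℝ → EuclideanSpace ℝ (Fin 3) → EuclideanSpace ℝ (Fin 3)} {p : ℝ → EuclideanSpace ℝ (Fin 3) → ℝ}
    (hcl : IsClassicalNSSolutionOn (Ico 0 T) ν 0 u p) (hLH : IsLerayHopfOn T ν 0 (u 0) u)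
    (hdec : HasRapidSpatialDecay (u 0)) (hMTI : MorreyTypeINear u T) :
    ∃ c : ℝ, 2 ≤ c ∧ ∃ r₁ : ℝ, 0 < r₁ ∧ ∃ K : ℝ, 0 ≤ K ∧
      ∀ t ∈ Ioo 0 T, ∀ r : ℝ, c * Real.sqrt (T - t) ≤ r → r < r₁ → ∀ x : EuclideanSpace ℝ (Fin 3),
        (∫⁻ z in Ioo t T ×ˢ ball x r, ENNReal.ofReal (frobeniusNormSq (fderiv ℝ (u z.1) z.2))) ≤
            ENNReal.ofReal (K * r) ∧
        (∫⁻ z in Ioo t T ×ˢ ball x r, ‖u z.1 z.2‖ₑ ^ (3 : ℕ)) ≤ ENNReal.ofReal (K * r ^ 2) := by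
  obtain ⟨ε₁, hε₁, K_E, hKE, K_C, hKC, h⟩ := exists_topCylinder_bounds
  obtain ⟨M, hM, r₁, hr₁, hMor⟩ := hMTI
  set κ : ℝ := ε₁ * min ν⁻¹ (ν ^ 3 / M ^ 2) with hκ
  have hκpos : 0 < κ := by rw [hκ]; exact mul_pos hε₁ (lt_min (inv_pos.2 hν) (by positivity))
  set c : ℝ := max 2 (Real.sqrt κ)⁻¹ with hc
  have hc2 : 2 ≤ c := le_max_left _ _
  have hcpos : 0 < c := lt_of_lt_of_le two_pos hc2
  refine ⟨c, hc2, r₁, hr₁, max (K_E * M / ν) (K_C * M ^ (3 / 2 : ℝ) / ν), le_max_of_le_left (by positivity), ?_⟩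
  intro t ht r hcr hrr₁ x
  have hTt : 0 < T - t := sub_pos.2 ht.2
  have hsq : 0 < Real.sqrt (T - t) := Real.sqrt_pos.2 hTt
  have hr : 0 < r := lt_of_lt_of_le (mul_pos hcpos hsq) hcr
  have hsq2 : Real.sqrt (T - t) ^ 2 = T - t := Real.sq_sqrt hTt.le
  -- `r ≥ 2 √(T-t)` ⇒ `T - r² < t`
  have htop : T - r ^ 2 < t := by
    have h1 : 2 * Real.sqrt (T - t) ≤ r := (mul_le_mul_of_nonneg_right hc2 hsq.le).trans hcr
    have h2 : 4 * (T - t) ≤ r ^ 2 := by nlinarith [hsq.le]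
    linarith
  -- `r ≥ √(T-t)/√κ` ⇒ `T - t ≤ κ r²`
  have hwin : T - t ≤ ε₁ * r ^ 2 * min ν⁻¹ (ν ^ 3 / M ^ 2) := by
    have hsk : 0 < Real.sqrt κ := Real.sqrt_pos.2 hκpos
    have h1 : (Real.sqrt κ)⁻¹ * Real.sqrt (T - t) ≤ r := (mul_le_mul_of_nonneg_right (le_max_right _ _) hsq.le).trans hcr
    have h2 : Real.sqrt (T - t) ≤ Real.sqrt κ * r := by
      rw [inv_mul_le_iff₀ hsk] at h1
      exact h1
    have h3 : T - t ≤ κ * r ^ 2 := by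
      have := pow_le_pow_left₀ hsq.le h2 2
      rw [hsq2, mul_pow, Real.sq_sqrt hκpos.le] at this
      exact this
    calc T - t ≤ κ * r ^ 2 := h3
      _ = ε₁ * r ^ 2 * min ν⁻¹ (ν ^ 3 / M ^ 2) := by rw [hκ]; ring
  obtain ⟨hE, hC⟩ := h ν T hν hT u p hcl hLH hdec M r₁ hM hr₁ hMor t ht r hr hrr₁ htop hwin x
  refine ⟨hE.trans (ENNReal.ofReal_le_ofReal ?_), hC.trans (ENNReal.ofReal_le_ofReal ?_)⟩
  · have : K_E * M * r / ν = (K_E * M / ν) * r := by ring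
    rw [this]
    exact mul_le_mul_of_nonneg_right (le_max_left _ _) hr.le
  · have : K_C * M ^ (3 / 2 : ℝ) * r ^ 2 / ν = (K_C * M ^ (3 / 2 : ℝ) / ν) * r ^ 2 := by ring
    rw [this]
    exact mul_le_mul_of_nonneg_right (le_max_right _ _) (by positivity)

/-- **Time-averaged local `L³`-Type-I pace on the parabolic top cylinders of a Morrey-Type-I frame solution.**
With the constants `c, r₁, K` of `exists_topCylinder_bounds_of_morreyTypeINear`: at every late time `t` (so late
that `c √(T-t) < r₁`) and every centre `x`, `∫_t^T ∫_{B(x, c√(T-t))} |u|³ ≤ K c² (T - t)` — per unit time the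
parabolic ball carries `≲ (T-t)^0` of `|u|³` on average, the local time-averaged form of `L3Slow`'s
`‖u(t')‖₃³ ≲ (T-t')^{-1/2}` integrated over `(t,T)`. -/
theorem cubic_parabolicTop_le_of_morreyTypeINear {ν T : ℝ} (hν : 0 < ν) (hT : 0 < T)
    {u : ℝ → EuclideanSpace ℝ (Fin 3) → EuclideanSpace ℝ (Fin 3)} {p : ℝ → EuclideanSpace ℝ (Fin 3) → ℝ}
    (hcl : IsClassicalNSSolutionOn (Ico 0 T) ν 0 u p) (hLH : IsLerayHopfOn T ν 0 (u 0) u)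
    (hdec : HasRapidSpatialDecay (u 0)) (hMTI : MorreyTypeINear u T) :
    ∃ c : ℝ, 2 ≤ c ∧ ∃ K : ℝ, 0 ≤ K ∧ ∃ T₁ < T, ∀ t ∈ Ioo T₁ T, ∀ x : EuclideanSpace ℝ (Fin 3),
      (∫⁻ z in Ioo t T ×ˢ ball x (c * Real.sqrt (T - t)), ‖u z.1 z.2‖ₑ ^ (3 : ℕ)) ≤
        ENNReal.ofReal (K * c ^ 2 * (T - t)) := by
  obtain ⟨c, hc2, r₁, hr₁, K, hK, h⟩ := exists_topCylinder_bounds_of_morreyTypeINear hν hT hcl hLH hdec hMTI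
  have hcpos : 0 < c := lt_of_lt_of_le two_pos hc2
  -- late times: `c √(T-t) < r₁ ⟺ T - t < (r₁/c)²`
  refine ⟨c, hc2, K, hK, max 0 (T - (r₁ / c) ^ 2), max_lt hT (by nlinarith [div_pos hr₁ hcpos]), ?_⟩
  intro t ht x
  have ht0 : 0 < t := lt_of_le_of_lt (le_max_left _ _) ht.1
  have hTt : 0 < T - t := sub_pos.2 ht.2
  have hlate : T - t < (r₁ / c) ^ 2 := by linarith [lt_of_le_of_lt (le_max_right 0 (T - (r₁ / c) ^ 2)) ht.1]
  have hr1 : c * Real.sqrt (T - t) < r₁ := by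
    have h1 : Real.sqrt (T - t) < r₁ / c := by
      rw [show r₁ / c = Real.sqrt ((r₁ / c) ^ 2) from (Real.sqrt_sq (by positivity)).symm]
      exact Real.sqrt_lt_sqrt hTt.le hlate
    calc c * Real.sqrt (T - t) < c * (r₁ / c) := mul_lt_mul_of_pos_left h1 hcpos
      _ = r₁ := by field_simp
  obtain ⟨-, hC⟩ := h t ⟨ht0, ht.2⟩ (c * Real.sqrt (T - t)) le_rfl hr1 x
  refine hC.trans (le_of_eq ?_)
  rw [mul_pow, Real.sq_sqrt hTt.le, mul_assoc]

end Summit.NavierStokesRegularity.NavierStokesRegularity.Theorems.L3TimeExponentPincerMorreyTypeITopCylinders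

end
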